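import Mathlib
import HarnessLib
import Summits.NavierStokesRegularity.NavierStokesRegularity.Theorems.PoloidalWindowDoorLrcModEntireUntwistedNormalForm
import Summits.NavierStokesRegularity.NavierStokesRegularity.Theorems.PoloidalWindowDoorPoloidalWindowRigidityUntwistedDynamicsAnalytic
import Summits.NavierStokesRegularity.NavierStokesRegularity.Theorems.PoloidalWindowDoorPoloidalWindowRigidityUntwistedStuartTranslation3
import Summits.NavierStokesRegularity.NavierStokesRegularity.Theorems.PoloidalWindowDoorPoloidalWindowRigidityEntireGerm
import Summits.NavierStokesRegularity.NavierStokesRegularity.Theorems.PoloidalWindowDoorPoloidalWindowRigidityLocalVorticitySymmetry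
import Summits.NavierStokesRegularity.NavierStokesRegularity.Theorems.PoloidalWindowDoorPoloidalWindowRigidityOneSliceCurlAxisymmetric

/-!
# Route `PoloidalWindowDoor`, crux `PoloidalWindowRigidity` (K2, stmt-NavierStokesRegularity-19708), skeleton `lrc-jet` v5 — THE STUB
# `stub_untwisted` PROVED: a non-degenerate UNTWISTED poloidal class profile is not backward-singular at the apex

Cell ns-regularity-ideate, seat ns-poloidal-K2-p3 (gen 6; file landed `--supports stmt-NavierStokesRegularity-19708`, proving the REGISTERED stub
`stub_untwisted` of `Cruxes/PoloidalWindowRigidity/Lines/lrc_jet.lean` v5 BY NAME AND SIGNATURE; the closer was assigned to this seat by the K2 lead,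
ns-poloidal-K2-p1 g6, STATUS 18:36Z).  Paper proof: the lead's `Cruxes/PoloidalWindowRigidity/UNTWISTED-NOTE.md` §3.  Lean chain (three seats):
F2 = ns-poloidal-K2-p2 g5 (`…UntwistedDynamicsAnalytic.untwisted_normalForm_analytic`, p559247, on p554131/p555299/p557324); F3/F4 = the lead
(`…UntwistedSeparation{,2}`, `…UntwistedStuartBranch`, `…UntwistedStuartTranslation{,2,3,Analytic}`, `branch2b_false` p556680); F1/F5 + glue +
dichotomy = this seat (`…UntwistedKinematics`, `…UntwistedSliceGlue`, `…UntwistedIsoparametric{,Class}`, `…UntwistedLeafRegularity`,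
`…UntwistedLeafwiseGerm`, `…LrcModEntireUntwistedNormalForm.lrcGerm_or_stuartBranch_of_untwistedNormalForm` p557241).

* `stub_untwisted` — **class + poloidal along `e₃` + nonempty open non-degenerate `W` in the backward slab + twist bracket `{∂₂v₂, v₂}ₕ ≡ 0` on `W`
  ⇒ `¬ IsBackwardSingularPoint v 0`.**  Proof: pick `(t, y₀) ∈ W`; F2 gives the normal form on an open `U ∋ y₀`; the dichotomy gives a Killing germ of
  the vorticity on some slice — hence a regular apex by the tree's `nonflatLiouville_of_local_curl_translation` /
  `nonflatLiouville_of_curl_rotDefect_eq_zero_on_open` (the entire leg being absurd in the class, `…EntireGerm`) — or the Stuart-branch data,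
  contradictory by `branch2b_false`.
  (The companion `…LrcModEntireUntwistedGerm.stub_untwistedGerm` is the same theorem in the germ currency of item 20428.)

WHAT THIS IS NOT: not a claim about Navier–Stokes regularity and not crux K2 (whose `stub_twisting` — «no non-degenerate twisting poloidal class profile
off the constant-slope stratum» — remains the research residue): ONE registered stub of skeleton lrc-jet v5, kernel-checked (bears_on LADDER-NS N0 via
crux 19708; rung N0-LocalTubeDoorPoloidal).
-/

noncomputable section

-- the summit and its single sub-problem share the name (CONVENTIONS §1), as in every Theorems file
set_option linter.dupNamespace false

namespace Summit.NavierStokesRegularity.NavierStokesRegularity.Theorems.PoloidalWindowDoorPoloidalWindowRigidityUntwisted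

open Set Function Filter Topology Metric
open scoped RealInnerProductSpace InnerProductSpace ContDiff
open Literature.Analysis Literature.Analysis.FluidPDE
open Summit.NavierStokesRegularity.NavierStokesRegularity.Theorems.LocalSineTubeDoorProfileAlignedWindowRigidityAncient
open Summit.NavierStokesRegularity.NavierStokesRegularity.Theorems.PoloidalWindowDoorPoloidalWindowRigidityConstantShearMeans
open Summit.NavierStokesRegularity.NavierStokesRegularity.Theorems.PoloidalWindowDoorLrcModEntireUntwistedNormalForm
open Summit.NavierStokesRegularity.NavierStokesRegularity.Theorems.PoloidalWindowDoorPoloidalWindowRigidityUntwistedDynamicsAnalytic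
open Summit.NavierStokesRegularity.NavierStokesRegularity.Theorems.PoloidalWindowDoorPoloidalWindowRigidityUntwistedStuartTranslation3
open Summit.NavierStokesRegularity.NavierStokesRegularity.Theorems.PoloidalWindowDoorPoloidalWindowRigidityEntireGerm
open Summit.NavierStokesRegularity.NavierStokesRegularity.Theorems.PoloidalWindowDoorPoloidalWindowRigidityLocalVorticitySymmetry
open Summit.NavierStokesRegularity.NavierStokesRegularity.Theorems.PoloidalWindowDoorPoloidalWindowRigidityOneSliceCurlAxisymmetric

/-- **STUB `stub_untwisted` OF SKELETON lrc-jet v5 OF CRUX K2 `PoloidalWindowRigidity` (stmt-NavierStokesRegularity-19708), PROVED.**  For a profile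
of the route's Type-I class, poloidal along `e₃`: on a nonempty open space–time subset `W` of the backward slab on which the profile is non-degenerate
(`curl v ≠ 0`, `∇ₕv₂ ≠ 0`, `∂₂vₕ ≠ 0` pointwise) and the vortex-line foliation is UNTWISTED (the planar bracket `∂₀(∂₂v₂)·∂₁v₂ − ∂₁(∂₂v₂)·∂₀v₂` vanishes
pointwise), the apex is regular.  No hypothesis on the shear slope.  (UNTWISTED-NOTE §3: normal form ⇒ separation of variables in the height ⇒ isoparametric
leaves or the empty Stuart branch ⇒ planar Levi-Civita–Segre ⇒ a Killing germ of the vorticity ⇒ the profile vanishes.) [folklore] -/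
theorem stub_untwisted :

    ∀ (C : ℝ) (v : ℝ → EuclideanSpace ℝ (Fin 3) → EuclideanSpace ℝ (Fin 3)),
      Literature.Analysis.FluidPDE.HasTypeITimeDecay C v →
      ContinuousOn (Function.uncurry v) (Set.Iio (0 : ℝ) ×ˢ Set.univ) →
      (∀ s t : ℝ, s < t → t < 0 → ∀ x, v t x =
        Literature.Analysis.UnboundedOperators.heatExtension (v s) (t - s) x -
          Literature.Analysis.FluidPDE.oseenDuhamel 1 s v v t x) →
      (∀ t < 0, Literature.Analysis.FluidPDE.VectorCalculus.IsDivFree (v t)) →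
      (∀ s < 0, ∀ y, ⟪Literature.Analysis.FluidPDE.curl (v s) y, EuclideanSpace.single 2 1⟫_ℝ = 0) →
      ∀ W : Set (ℝ × EuclideanSpace ℝ (Fin 3)), IsOpen W → W.Nonempty → W ⊆ Set.Iio (0 : ℝ) ×ˢ Set.univ →
        (∀ z ∈ W, Literature.Analysis.FluidPDE.curl (v z.1) z.2 ≠ 0 ∧
          (fderiv ℝ (v z.1) z.2 (EuclideanSpace.single 0 1) 2 ≠ 0 ∨ fderiv ℝ (v z.1) z.2 (EuclideanSpace.single 1 1) 2 ≠ 0) ∧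
          (fderiv ℝ (v z.1) z.2 (EuclideanSpace.single 2 1) 0 ≠ 0 ∨ fderiv ℝ (v z.1) z.2 (EuclideanSpace.single 2 1) 1 ≠ 0)) →
        (∀ z ∈ W,
          fderiv ℝ (fun x => fderiv ℝ (v z.1) x (EuclideanSpace.single 2 1) 2) z.2 (EuclideanSpace.single 0 1) *
              fderiv ℝ (v z.1) z.2 (EuclideanSpace.single 1 1) 2 -
            fderiv ℝ (fun x => fderiv ℝ (v z.1) x (EuclideanSpace.single 2 1) 2) z.2 (EuclideanSpace.single 1 1) *
              fderiv ℝ (v z.1) z.2 (EuclideanSpace.single 0 1) 2 = 0) →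
        ¬ Literature.Analysis.FluidPDE.IsBackwardSingularPoint v 0 := by
  intro C v hrate hcont hmild hdiv hpol W hW hWne hWs hnd htw
  obtain ⟨z₀, hz₀⟩ := hWne
  obtain ⟨t, y₀⟩ := z₀
  have ht : t < 0 := (Set.mem_prod.1 (hWs hz₀)).1
  -- F2: the analytic untwisted normal form on an open `U ∋ y₀` of the slice `t`
  obtain ⟨U, hUo, hy₀U, -, P, Λ, k, pt, hPA, hΛA, hkA, -, hSd, hP, hndU, hL0, hL1, -, hK1, hV0, hSz⟩ :=
    untwisted_normalForm_analytic hrate hcont hmild hdiv hpol hW hWs hnd htw hz₀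
  -- regularity conversions
  have hPd : ∀ y ∈ U, ContDiffAt ℝ 2 P (v t y 2, y 2) := fun y hy => (hPA y hy).contDiffAt
  have hΛd : ∀ y ∈ U, ContDiffAt ℝ 2 Λ (v t y 2, y 2) := fun y hy => (hΛA y hy).contDiffAt
  have hkd : ∀ y ∈ U, DifferentiableAt ℝ k (v t y 2, y 2) := fun y hy => (hkA y hy).differentiableAt
  have hcd : ∀ y ∈ U, DifferentiableAt ℝ (fun q : ℝ × ℝ => fderiv ℝ P q (P q, 1)) (v t y 2, y 2) := by
    intro y hy
    have h1 : ContDiffAt ℝ 1 (fderiv ℝ P) (v t y 2, y 2) := (hPA y hy).contDiffAt.fderiv_right (m := 1) le_top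
    have h2 : ContDiffAt ℝ 1 (fun q : ℝ × ℝ => (P q, (1 : ℝ))) (v t y 2, y 2) :=
      ((hPA y hy).contDiffAt.of_le le_top).prodMk contDiffAt_const
    exact (h1.clm_apply h2).differentiableAt one_ne_zero
  -- THE DICHOTOMY
  rcases lrcGerm_or_stuartBranch_of_untwistedNormalForm hrate hcont hmild hdiv hpol ht (w := fun x => v t x 2) rfl hUo hy₀U
      (c := fun q : ℝ × ℝ => fderiv ℝ P q (P q, 1)) hPd hΛd hcd hkd hSd hL0 hndU hP (fun _ _ => rfl) hK1 hV0 hSz with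
    ⟨s, hs, U', hU'o, hU'ne, hgerm⟩ | ⟨U', hU'o, hy₀', hU'U, b, hb, hbne, hD1, hD2, hD3⟩
  · -- a Killing germ of the vorticity on an open set of one slice ⇒ the apex is regular (tree); the entire leg is absurd in the class
    rcases hgerm with ⟨e, he, htr⟩ | ⟨c', hrot⟩ | ⟨W', hW', hunb, heq⟩
    · exact nonflatLiouville_of_local_curl_translation hrate hcont hmild hdiv hs he hU'o hU'ne htr
    · exact nonflatLiouville_of_curl_rotDefect_eq_zero_on_open hrate hcont hmild hdiv hpol c' hs hU'o hU'ne hrot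
    · exact absurd heq (not_slice_eqOn_open_of_not_bddAbove hrate hcont hmild hs hW' hunb hU'o hU'ne)
  · -- the Stuart branch is empty (the K2 lead's `branch2b_false`)
    have hA : AnalyticOnNhd ℝ (v t) univ := analyticOnNhd_slice hcont (bdd_of_hasTypeITimeDecay hrate) hmild ht
    have hwA : AnalyticOnNhd ℝ (fun x => v t x 2) univ := fun x _ =>
      ((EuclideanSpace.proj (𝕜 := ℝ) (2 : Fin 3)).analyticAt _).comp (hA x (mem_univ x))
    exact (branch2b_false hU'o hy₀' hb hwA (fun y hy => hPA y (hU'U hy)) (fun y hy => hΛA y (hU'U hy))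
      (fun y hy => hP y (hU'U hy)) hbne (fun y hy => hL0 y (hU'U hy)) (fun y hy => hL1 y (hU'U hy)) hD1 hD2 hD3).elim

end Summit.NavierStokesRegularity.NavierStokesRegularity.Theorems.PoloidalWindowDoorPoloidalWindowRigidityUntwisted

end
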